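import Literature.Geometry.Riemannian.ThreeShrinkerDegenerateDevelopingGlue
import Literature.Geometry.Riemannian.RoundCylinderThreeVolume
import Literature.Geometry.Riemannian.RiemannianCoveringCriterion
import Literature.Geometry.Riemannian.RiemannianCoveringComplete
import Literature.Geometry.Riemannian.HadamardExpCovering
import HarnessLib

/-!
# Degenerate three-dimensional shrinkers: the developing map is a Riemannian covering

Continuation of `ThreeShrinkerDegenerateDevelopingGlue` (degenerate case of Munteanu–Wang 2016,
Thm. 1.2). The model cylinder `C = (ℝ³ ∖ 0, g_c = 2|y|⁻² δ)` is complete (its closed distance balls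
are compact, `RoundCylinderThree.isCompact_setOf_edist_le`, and Hopf–Rinow), so a smooth isometric
immersion `Φ : C → M` into a complete connected `M` is surjective and a covering map (the tree's
Cartan–Ambrose–Hicks criterion `CartanHadamard.surjective_and_isCoveringMap_of_isGeodesicallyComplete`
applied to `Φ^* g = g_c`). We package the conclusions of `exists_isometric_developing` in the
predicate `IsDeveloping` and record: injectivity of `dΦ`, `Φ^* g = g_c`, local diffeomorphy,
surjectivity and the covering property.

Everything is proved; `IsDeveloping` is a `structure … : Prop` of hypotheses, not a named fact
(D-0026).

## References

* O. Munteanu, J. Wang, arXiv:1606.01861, Thm. 1.2 (p. 3). [MunteanuWang2016]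
* J. M. Lee, *Introduction to Riemannian Manifolds*, 2nd ed., Springer 2018, Thm. 6.23. [Lee2018]
* B. O'Neill, *Semi-Riemannian Geometry*, Academic Press 1983, Ch. 5, Thm. 21; Ch. 7, Cor. 29.
  [ONeill1983]
-/

noncomputable section

open Bundle Set Function Filter Module Metric
open scoped Manifold ContDiff Topology NNReal RealInnerProductSpace

namespace Literature.Geometry.Riemannian

open Lorentzian Lorentzian.PseudoRiemannianMetric RoundCylinderThree

/-! ### Completeness of the model cylinder -/

namespace RoundCylinderThree

/-- `ℝ³ ∖ 0` is nonempty. [folklore] -/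
instance : Nonempty P3 := ⟨basePt DegenerateShrinker.o₀⟩

/-- **The model cylinder is geodesically complete** (compact closed distance balls + Hopf–Rinow).
[cite: ONeill1983, Ch. 5, Thm. 21] -/
theorem isGeodesicallyComplete_cyl3 : IsGeodesicallyComplete cyl3.leviCivita :=
  HadamardExpCovering.isGeodesicallyComplete_of_isCompact_setOf_edist_le (g := cyl3)
    isRiemannian_cyl3 isCompact_setOf_edist_le

end RoundCylinderThree

/-! ### Developing maps -/

variable {M : Type*} [TopologicalSpace M] [ChartedSpace (EuclideanSpace ℝ (Fin 3)) M]
  [IsManifold (𝓡 3) ∞ M]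
  (g : PseudoRiemannianMetric (𝓡 3) ∞ (EuclideanSpace ℝ (Fin 3)) (TangentSpace (𝓡 3) : M → Type _))
  [g.HasLeviCivita]

namespace DegenerateShrinker

/-- **A developing map** of `(M, g, f)`: a `C^∞` map `Φ : C → M` with `g(dΦ u, dΦ w) = g_c(u, w)`,
`f ∘ Φ = f_C`, and `dΦ_y(y)` a `Ric`-null vector of `g`-length `√2` (the conclusions of
`exists_isometric_developing`). [cite: MunteanuWang2016, Thm. 1.2] -/
structure IsDeveloping (f : M → ℝ) (Φ : P3 → M) : Prop where
  smooth : ContMDiff 𝓘(ℝ, E3) (𝓡 3) ∞ Φ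
  iso : ∀ (y : P3) (u w : TangentSpace 𝓘(ℝ, E3) y),
    g.val (Φ y) (mfderiv 𝓘(ℝ, E3) (𝓡 3) Φ y u) (mfderiv 𝓘(ℝ, E3) (𝓡 3) Φ y w) = cyl3.val y u w
  potential : ∀ y : P3, f (Φ y) = fP y
  radial : ∀ y : P3, g.val (Φ y) (mfderiv 𝓘(ℝ, E3) (𝓡 3) Φ y (y : E3))
      (mfderiv 𝓘(ℝ, E3) (𝓡 3) Φ y (y : E3)) = 2 ∧
    g.ricci (Φ y) (mfderiv 𝓘(ℝ, E3) (𝓡 3) Φ y (y : E3))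
      (mfderiv 𝓘(ℝ, E3) (𝓡 3) Φ y (y : E3)) = 0

variable {g} {f : M → ℝ} {Φ : P3 → M}

namespace IsDeveloping

/-- `Φ` is `C^{∞+1} = C^∞`. [folklore] -/
theorem smooth' (h : IsDeveloping g f Φ) : ContMDiff 𝓘(ℝ, E3) (𝓡 3) (∞ + 1) Φ := h.smooth

/-- **`dΦ` is injective** (`g(dΦ v, dΦ v) = g_c(v, v) > 0` for `v ≠ 0`). [folklore] -/
theorem injective_mfderiv (h : IsDeveloping g f Φ) (y : P3) :
    Injective (mfderiv 𝓘(ℝ, E3) (𝓡 3) Φ y) := by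
  intro v w hvw
  by_contra hne
  have hpos := isRiemannian_cyl3 y (v - w) (sub_ne_zero.2 hne)
  rw [← h.iso y, map_sub, hvw, sub_self, map_zero] at hpos
  exact lt_irrefl _ hpos

/-- The dimension hypothesis of the pullback. [folklore] -/
theorem hdim : finrank ℝ E3 = finrank ℝ (EuclideanSpace ℝ (Fin 3)) := rfl

/-- **`Φ^* g = g_c`.** [folklore] -/
theorem comap_eq (h : IsDeveloping g f Φ) :
    g.comap contMDiff_pullbackBilin_holds Φ h.smooth' h.injective_mfderiv hdim = cyl3 := by
  ext y u w
  rw [val_comap, pullbackBilin_apply]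
  exact h.iso y u w

/-- **`Φ` is a local diffeomorphism.** [cite: ONeill1983, Ch. 1, Thm. 1.16] -/
theorem isLocalDiffeomorph (h : IsDeveloping g f Φ) : IsLocalDiffeomorph 𝓘(ℝ, E3) (𝓡 3) ∞ Φ :=
  RiemannianCovering.isLocalDiffeomorph_of_injective_mfderiv (I := 𝓡 3) (I' := 𝓘(ℝ, E3))
    h.smooth' h.injective_mfderiv hdim

/-- **A developing map into a complete connected `M` is surjective and a covering map.**
[cite: Lee2018, Thm. 6.23] [cite: ONeill1983, Ch. 7, Cor. 29] -/
theorem surjective_and_isCoveringMap [T2Space M] [ConnectedSpace M] (h : IsDeveloping g f Φ)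
    (hc : IsGeodesicallyComplete g.leviCivita) : Surjective Φ ∧ IsCoveringMap Φ := by
  haveI := contMDiffCovariantDerivative_leviCivita_one g
  haveI := contMDiffCovariantDerivative_leviCivita_infty g le_rfl
  set gt := g.comap contMDiff_pullbackBilin_holds Φ h.smooth' h.injective_mfderiv hdim with hgt
  haveI hLCt : gt.HasLeviCivita := gt.hasLeviCivita
  haveI := contMDiffCovariantDerivative_leviCivita_one gt
  haveI := contMDiffCovariantDerivative_leviCivita_infty gt le_rfl
  have key : ∀ (m : PseudoRiemannianMetric 𝓘(ℝ, E3) ∞ E3 (TangentSpace 𝓘(ℝ, E3) : P3 → Type _))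
      [m.HasLeviCivita], m = cyl3 → IsGeodesicallyComplete m.leviCivita := by
    intro m _ hm
    subst hm
    exact RoundCylinderThree.isGeodesicallyComplete_cyl3
  have hcN : IsGeodesicallyComplete gt.leviCivita := key gt h.comap_eq
  exact CartanHadamard.surjective_and_isCoveringMap_of_isGeodesicallyComplete (g := g) (f := Φ)
    (hpb := contMDiff_pullbackBilin_holds) (hf := h.smooth') (hf' := h.injective_mfderiv)
    (hdim := hdim) hcN hc

end IsDeveloping

section Along

variable (g)
variable [T2Space M] [ConnectedSpace M]
  (hg : ∀ (x : M) (v : TangentSpace (𝓡 3) x), v ≠ 0 → 0 < g.val x v v)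
  (hf : ContMDiff (𝓡 3) 𝓘(ℝ, ℝ) ∞ f) {lam : ℝ}
  (hsol : ∀ (x : M) (X Y : TangentSpace (𝓡 3) x),
    g.ricci x X Y + g.hessian f x X Y = lam * g.val x X Y)
  (hRic0 : ∀ (x : M) (w : TangentSpace (𝓡 3) x), 0 ≤ g.ricci x w w)
  (hS : ∀ x, 0 < g.scalarCurvature x) {p₀ : M} {w₀ : TangentSpace (𝓡 3) p₀} (hw₀ : w₀ ≠ 0)
  (hnull : g.ricci p₀ w₀ w₀ = 0)
  {κ : (x : M) → TangentSpace (𝓡 3) x → ℝ}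
  (hκ : ∀ (x : M) (w : TangentSpace (𝓡 3) x),
    κ x w = g.val x w w - 2 / g.scalarCurvature x * g.ricci x w w)

include hg hf hsol hRic0 hS hw₀ hnull hκ in
/-- **Existence of a developing map through a point of `{f = 1}`**, for a complete connected
normalised degenerate three-dimensional shrinker with `S ≡ 1` (`exists_isometric_developing`).
[cite: MunteanuWang2016, Thm. 1.2] -/
theorem exists_isDeveloping (hlam : lam = 1 / 2) (hS1 : ∀ x, g.scalarCurvature x = 1)
    (hc : IsGeodesicallyComplete g.leviCivita)
    (hnorm : ∀ x, g.scalarCurvature x + g.gradSq f x = f x) {p : M} (hfp : f p = 1) :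
    ∃ Φ : P3 → M, IsDeveloping g f Φ ∧ Φ (basePt o₀) = p := by
  obtain ⟨Φ, h1, h2, h3, h4, h5⟩ := exists_isometric_developing g hg hf hsol hRic0 hS hw₀ hnull hκ hlam
    hS1 hc hnorm hfp
  exact ⟨Φ, ⟨h1, h2, h3, h4⟩, h5⟩

end Along

end DegenerateShrinker

end Literature.Geometry.Riemannian

end
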